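import Literature.MathematicalPhysics.QuantumLattice.LiebMattisMatrixElements
import HarnessLib

/-!
# Block product states (cluster / "plaquette" product trial states)

Topic `MathematicalPhysics/QuantumLattice`; vocabulary of `SpinSystem.lean` (`TensorIndex Λ q = Λ → Fin q`,
`onSite x a`). Given a decomposition of the sites `e : Λ ≃ B × F` into blocks (`B` = block labels,
`F` = positions inside a block) and a block state `φ : (F → Fin q) → ℂ`, the **block product state**
`Ψ(σ) = ∏_b φ(σ|_{block b})` is the tensor product `⨂_b φ` written in coordinates. This file records
the elementary bookkeeping used by cluster ("plaquette") mean-field variational bounds on ground-state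
energies (e.g. the Anderson / Kubo–Kishi-type improvements of the sum-rule arguments for long-range
order): how single-site operators act on `Ψ` (they act on one factor), and the factorisation of the
inner products `⟨Ψ, a_x Ψ⟩ = ⟨φ, a_f φ⟩ ‖φ‖^{2(|B|-1)}`, `⟨Ψ, a_x a'_y Ψ⟩ = ⟨φ, a_f a'_{f'} φ⟩ ‖φ‖^{2(|B|-1)}`
(same block) and `= ⟨φ, a_f φ⟩⟨φ, a'_{f'} φ⟩ ‖φ‖^{2(|B|-2)}` (different blocks).

Everything here is finite-dimensional linear algebra (Fubini for finite sums); no analysis.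
Standard material: e.g. H. Tasaki, *Physics and Mathematics of Quantum Many-Body Systems* (2020),
§2.2 (tensor products in the `σ`-basis); the variational use is P. W. Anderson, Phys. Rev. 83 (1951)
1260 and its cluster refinements. What is NOT here: any specific lattice or block shape (see
`XYZGroundStateOrderPlaquette.lean` for the `2 × 2` plaquettes of the even square torus).
-/

noncomputable section

open Matrix Complex Finset

namespace Literature.MathematicalPhysics.QuantumLattice

variable {Λ B F : Type*} {q : ℕ}

/-! ### Definitions -/

/-- The configuration of block `b` read off from a configuration `σ` of `Λ`, along the block
decomposition `e : Λ ≃ B × F`: `(σ|_b)(f) = σ(e⁻¹(b, f))`. Tasaki (2020) §2.2. [folklore] -/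
def blockCfg (e : Λ ≃ B × F) (σ : TensorIndex Λ q) (b : B) : TensorIndex F q :=
  fun f => σ (e.symm (b, f))

/-- The **block product state** `Ψ = ⨂_b φ` in coordinates: `Ψ(σ) = ∏_b φ(σ|_b)`.
Tasaki (2020) §2.2, eq. (2.2.3)–(2.2.4). [folklore] -/
def blockProductState [Fintype B] (e : Λ ≃ B × F) (φ : TensorIndex F q → ℂ) :
    TensorIndex Λ q → ℂ :=
  fun σ => ∏ b, φ (blockCfg e σ b)

/-- The block product state with the factor of block `b₀` replaced by `χ`:
`σ ↦ χ(σ|_{b₀}) ∏_{b ≠ b₀} φ(σ|_b)`. [folklore] -/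
def blockMod [Fintype B] [DecidableEq B] (e : Λ ≃ B × F) (φ : TensorIndex F q → ℂ) (b₀ : B)
    (χ : TensorIndex F q → ℂ) : TensorIndex Λ q → ℂ :=
  fun σ => χ (blockCfg e σ b₀) * ∏ b ∈ univ.erase b₀, φ (blockCfg e σ b)

/-- The block product state with the factors of two blocks `b₀, b₁` replaced by `χ₀, χ₁`:
`σ ↦ χ₀(σ|_{b₀}) χ₁(σ|_{b₁}) ∏_{b ≠ b₀, b₁} φ(σ|_b)`. [folklore] -/
def blockMod₂ [Fintype B] [DecidableEq B] (e : Λ ≃ B × F) (φ : TensorIndex F q → ℂ) (b₀ b₁ : B)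
    (χ₀ χ₁ : TensorIndex F q → ℂ) : TensorIndex Λ q → ℂ :=
  fun σ => χ₀ (blockCfg e σ b₀) * (χ₁ (blockCfg e σ b₁) * ∏ b ∈ (univ.erase b₀).erase b₁, φ (blockCfg e σ b))

/-- Configurations of `Λ` are the same as families of block configurations:
`(Λ → Fin q) ≃ (B → (F → Fin q))` along `e`. Tasaki (2020) §2.2. [folklore] -/
def blockCfgEquiv (e : Λ ≃ B × F) : TensorIndex Λ q ≃ (B → TensorIndex F q) where
  toFun σ := blockCfg e σ
  invFun g := fun x => g (e x).1 (e x).2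
  left_inv σ := by
    funext x
    simp [blockCfg]
  right_inv g := by
    funext b f
    simp [blockCfg]

/-! ### Elementary rewriting -/

/-- The coordinate `σ x` is entry `(e x).2` of block `(e x).1`. [folklore] -/
theorem blockCfg_apply_fst_snd (e : Λ ≃ B × F) (σ : TensorIndex Λ q) (x : Λ) :
    blockCfg e σ (e x).1 (e x).2 = σ x := by
  simp [blockCfg]

/-- Updating one coordinate of `σ` updates one entry of one block configuration and leaves the
other blocks unchanged. [folklore] -/
theorem blockCfg_update [DecidableEq Λ] [DecidableEq B] [DecidableEq F] (e : Λ ≃ B × F)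
    (σ : TensorIndex Λ q) (x : Λ) (l : Fin q) (b : B) :
    blockCfg e (Function.update σ x l) b =
      if b = (e x).1 then Function.update (blockCfg e σ b) (e x).2 l else blockCfg e σ b := by
  split_ifs with hb
  · funext f
    simp only [blockCfg, Function.update_apply]
    have : (e.symm (b, f) = x) ↔ (f = (e x).2) := by
      rw [Equiv.symm_apply_eq, Prod.ext_iff]
      simp [hb]
    rw [if_congr this rfl rfl]
  · funext f
    simp only [blockCfg]
    rw [Function.update_of_ne]
    intro hx
    apply hb
    have := congrArg (fun y => (e y).1) hx
    simpa using this

section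

variable [Fintype Λ] [DecidableEq Λ] [Fintype B] [DecidableEq B] [Fintype F] [DecidableEq F]

omit [Fintype Λ] [DecidableEq Λ] [Fintype F] [DecidableEq F] in
/-- `Ψ = blockMod b₀ φ` for every block `b₀`. [folklore] -/
theorem blockProductState_eq_blockMod (e : Λ ≃ B × F) (φ : TensorIndex F q → ℂ) (b₀ : B) :
    blockProductState e φ = blockMod e φ b₀ φ := by
  funext σ
  simp only [blockProductState, blockMod]
  exact (mul_prod_erase univ (fun b => φ (blockCfg e σ b)) (mem_univ b₀)).symm

omit [Fintype Λ] [DecidableEq Λ] [Fintype F] [DecidableEq F] in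
/-- `blockMod b₀ χ = blockMod₂ b₀ b₁ χ φ` for `b₁ ≠ b₀`. [folklore] -/
theorem blockMod_eq_blockMod₂ (e : Λ ≃ B × F) (φ : TensorIndex F q → ℂ) {b₀ b₁ : B}
    (h : b₁ ≠ b₀) (χ : TensorIndex F q → ℂ) :
    blockMod e φ b₀ χ = blockMod₂ e φ b₀ b₁ χ φ := by
  funext σ
  simp only [blockMod, blockMod₂]
  congr 1
  exact (mul_prod_erase (univ.erase b₀) (fun b => φ (blockCfg e σ b)) (mem_erase.2 ⟨h, mem_univ b₁⟩)).symm

/-! ### Single-site operators act on one factor -/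

/-- A single-site operator at a site of block `b₀` acts on the `b₀`-factor:
`a_x (χ ⊗ ⨂_{b≠b₀} φ) = (a_f χ) ⊗ ⨂_{b≠b₀} φ` for `e x = (b₀, f)`. Tasaki (2020) §2.2, eq. (2.2.5). [folklore] -/
theorem onSite_mulVec_blockMod_same (e : Λ ≃ B × F) (φ : TensorIndex F q → ℂ) {x : Λ} {b₀ : B}
    {f₀ : F} (hx : e x = (b₀, f₀)) (a : Matrix (Fin q) (Fin q) ℂ) (χ : TensorIndex F q → ℂ) :
    onSite x a *ᵥ blockMod e φ b₀ χ = blockMod e φ b₀ (onSite f₀ a *ᵥ χ) := by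
  funext σ
  rw [LiebMattis.onSite_mulVec_apply]
  simp only [blockMod]
  rw [LiebMattis.onSite_mulVec_apply, sum_mul]
  refine sum_congr rfl fun l _ => ?_
  have h1 : blockCfg e (Function.update σ x l) b₀ = Function.update (blockCfg e σ b₀) f₀ l := by
    rw [blockCfg_update, if_pos (by rw [hx]), hx]
  have h2 : ∀ b ∈ univ.erase b₀, φ (blockCfg e (Function.update σ x l) b) = φ (blockCfg e σ b) := by
    intro b hb
    rw [blockCfg_update, if_neg]
    rw [hx]
    exact (mem_erase.1 hb).1
  have h3 : σ x = blockCfg e σ b₀ f₀ := by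
    rw [← blockCfg_apply_fst_snd e σ x, hx]
  rw [h1, prod_congr rfl h2, h3, mul_assoc]

/-- A single-site operator at a site of block `b₁ ≠ b₀` acts on the `b₁`-factor of a state already
modified in block `b₀`. Tasaki (2020) §2.2, eq. (2.2.5). [folklore] -/
theorem onSite_mulVec_blockMod₂_snd (e : Λ ≃ B × F) (φ : TensorIndex F q → ℂ) {x : Λ} {b₀ b₁ : B}
    {f₁ : F} (hx : e x = (b₁, f₁)) (h : b₁ ≠ b₀) (a : Matrix (Fin q) (Fin q) ℂ)
    (χ₀ χ₁ : TensorIndex F q → ℂ) :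
    onSite x a *ᵥ blockMod₂ e φ b₀ b₁ χ₀ χ₁ = blockMod₂ e φ b₀ b₁ χ₀ (onSite f₁ a *ᵥ χ₁) := by
  funext σ
  rw [LiebMattis.onSite_mulVec_apply]
  simp only [blockMod₂]
  rw [LiebMattis.onSite_mulVec_apply, sum_mul, mul_sum]
  refine sum_congr rfl fun l _ => ?_
  have h0 : blockCfg e (Function.update σ x l) b₀ = blockCfg e σ b₀ := by
    rw [blockCfg_update, if_neg]
    rw [hx]
    exact fun h' => h h'.symm
  have h1 : blockCfg e (Function.update σ x l) b₁ = Function.update (blockCfg e σ b₁) f₁ l := by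
    rw [blockCfg_update, if_pos (by rw [hx]), hx]
  have h2 : ∀ b ∈ (univ.erase b₀).erase b₁,
      φ (blockCfg e (Function.update σ x l) b) = φ (blockCfg e σ b) := by
    intro b hb
    rw [blockCfg_update, if_neg]
    rw [hx]
    exact (mem_erase.1 hb).1
  have h3 : σ x = blockCfg e σ b₁ f₁ := by
    rw [← blockCfg_apply_fst_snd e σ x, hx]
  rw [h0, h1, prod_congr rfl h2, h3]
  ring

/-- A single-site operator at a site of block `b₁ ≠ b₀` applied to a state modified in block `b₀`
gives a state modified in the two blocks. [folklore] -/
theorem onSite_mulVec_blockMod_other (e : Λ ≃ B × F) (φ : TensorIndex F q → ℂ) {x : Λ} {b₀ b₁ : B}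
    {f₁ : F} (hx : e x = (b₁, f₁)) (h : b₁ ≠ b₀) (a : Matrix (Fin q) (Fin q) ℂ)
    (χ : TensorIndex F q → ℂ) :
    onSite x a *ᵥ blockMod e φ b₀ χ = blockMod₂ e φ b₀ b₁ χ (onSite f₁ a *ᵥ φ) := by
  rw [blockMod_eq_blockMod₂ e φ h, onSite_mulVec_blockMod₂_snd e φ hx h]

/-- A single-site operator applied to the block product state. [folklore] -/
theorem onSite_mulVec_blockProductState (e : Λ ≃ B × F) (φ : TensorIndex F q → ℂ) {x : Λ} {b₀ : B}
    {f₀ : F} (hx : e x = (b₀, f₀)) (a : Matrix (Fin q) (Fin q) ℂ) :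
    onSite x a *ᵥ blockProductState e φ = blockMod e φ b₀ (onSite f₀ a *ᵥ φ) := by
  rw [blockProductState_eq_blockMod e φ b₀, onSite_mulVec_blockMod_same e φ hx]

/-! ### Inner products factorise (Fubini) -/

/-- Fubini for the block decomposition: a sum over configurations of `Λ` of a product of block
functions is the product of the block sums, `Σ_σ ∏_b h_b(σ|_b) = ∏_b Σ_τ h_b(τ)`. [folklore] -/
theorem sum_prod_blockCfg (e : Λ ≃ B × F) (h : B → TensorIndex F q → ℂ) :
    ∑ σ : TensorIndex Λ q, ∏ b, h b (blockCfg e σ b) = ∏ b, ∑ τ : TensorIndex F q, h b τ := by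
  rw [Fintype.prod_sum]
  exact (blockCfgEquiv e).sum_comp (fun g : B → TensorIndex F q => ∏ b, h b (g b))

/-- **The norm of a block product state**: `⟨Ψ, Ψ⟩ = ⟨φ, φ⟩^{|B|}`. Tasaki (2020) §2.2. [folklore] -/
theorem star_blockProductState_dotProduct_self (e : Λ ≃ B × F) (φ : TensorIndex F q → ℂ) :
    star (blockProductState e φ) ⬝ᵥ blockProductState e φ = (star φ ⬝ᵥ φ) ^ Fintype.card B := by
  simp only [dotProduct, Pi.star_apply, blockProductState]
  have : ∀ σ : TensorIndex Λ q, star (∏ b, φ (blockCfg e σ b)) * ∏ b, φ (blockCfg e σ b) =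
      ∏ b, (fun (_ : B) (τ : TensorIndex F q) => star (φ τ) * φ τ) b (blockCfg e σ b) := by
    intro σ
    rw [star_prod, ← prod_mul_distrib]
  simp_rw [this]
  have key := sum_prod_blockCfg e (fun (_ : B) (τ : TensorIndex F q) => star (φ τ) * φ τ)
  beta_reduce at key
  rw [key, prod_const, card_univ]

/-- **One modified block**: `⟨Ψ, χ ⊗ ⨂_{b≠b₀} φ⟩ = ⟨φ, χ⟩ ⟨φ, φ⟩^{|B|-1}`. Tasaki (2020) §2.2. [folklore] -/
theorem star_blockProductState_dotProduct_blockMod (e : Λ ≃ B × F) (φ : TensorIndex F q → ℂ)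
    (b₀ : B) (χ : TensorIndex F q → ℂ) :
    star (blockProductState e φ) ⬝ᵥ blockMod e φ b₀ χ =
      (star φ ⬝ᵥ χ) * (star φ ⬝ᵥ φ) ^ (Fintype.card B - 1) := by
  simp only [dotProduct, Pi.star_apply, blockProductState, blockMod]
  set h : B → TensorIndex F q → ℂ := fun b τ => star (φ τ) * (if b = b₀ then χ τ else φ τ) with hh
  have key : ∀ σ : TensorIndex Λ q,
      star (∏ b, φ (blockCfg e σ b)) * (χ (blockCfg e σ b₀) * ∏ b ∈ univ.erase b₀, φ (blockCfg e σ b)) =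
      ∏ b, h b (blockCfg e σ b) := by
    intro σ
    rw [star_prod, ← mul_prod_erase _ _ (mem_univ b₀), ← mul_prod_erase univ (fun b => h b _) (mem_univ b₀)]
    have h1 : h b₀ (blockCfg e σ b₀) = star (φ (blockCfg e σ b₀)) * χ (blockCfg e σ b₀) := by
      simp [hh]
    have h2 : ∏ b ∈ univ.erase b₀, h b (blockCfg e σ b) =
        ∏ b ∈ univ.erase b₀, (star (φ (blockCfg e σ b)) * φ (blockCfg e σ b)) := by
      refine prod_congr rfl fun b hb => ?_
      simp [hh, (mem_erase.1 hb).1]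
    rw [h1, h2, prod_mul_distrib]
    ring
  simp_rw [key]
  rw [sum_prod_blockCfg, ← mul_prod_erase _ _ (mem_univ b₀)]
  have h1 : ∑ τ, h b₀ τ = ∑ τ, star (φ τ) * χ τ := by simp [hh]
  have h2 : ∏ b ∈ univ.erase b₀, ∑ τ, h b τ = ∏ b ∈ univ.erase b₀, ∑ τ, star (φ τ) * φ τ := by
    refine prod_congr rfl fun b hb => ?_
    simp [hh, (mem_erase.1 hb).1]
  rw [h1, h2, prod_const, card_erase_of_mem (mem_univ b₀), card_univ]

/-- **Two modified blocks**: `⟨Ψ, χ₀ ⊗ χ₁ ⊗ ⨂_{b≠b₀,b₁} φ⟩ = ⟨φ, χ₀⟩ ⟨φ, χ₁⟩ ⟨φ, φ⟩^{|B|-2}` for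
`b₁ ≠ b₀`. Tasaki (2020) §2.2. [folklore] -/
theorem star_blockProductState_dotProduct_blockMod₂ (e : Λ ≃ B × F) (φ : TensorIndex F q → ℂ)
    {b₀ b₁ : B} (hb : b₁ ≠ b₀) (χ₀ χ₁ : TensorIndex F q → ℂ) :
    star (blockProductState e φ) ⬝ᵥ blockMod₂ e φ b₀ b₁ χ₀ χ₁ =
      (star φ ⬝ᵥ χ₀) * (star φ ⬝ᵥ χ₁) * (star φ ⬝ᵥ φ) ^ (Fintype.card B - 2) := by
  simp only [dotProduct, Pi.star_apply, blockProductState, blockMod₂]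
  set h : B → TensorIndex F q → ℂ :=
    fun b τ => star (φ τ) * (if b = b₀ then χ₀ τ else if b = b₁ then χ₁ τ else φ τ) with hh
  have hmem : b₁ ∈ univ.erase b₀ := mem_erase.2 ⟨hb, mem_univ b₁⟩
  have key : ∀ σ : TensorIndex Λ q,
      star (∏ b, φ (blockCfg e σ b)) * (χ₀ (blockCfg e σ b₀) *
        (χ₁ (blockCfg e σ b₁) * ∏ b ∈ (univ.erase b₀).erase b₁, φ (blockCfg e σ b))) =
      ∏ b, h b (blockCfg e σ b) := by
    intro σ
    rw [star_prod, ← mul_prod_erase _ _ (mem_univ b₀), ← mul_prod_erase _ _ hmem,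
      ← mul_prod_erase univ (fun b => h b _) (mem_univ b₀),
      ← mul_prod_erase (univ.erase b₀) (fun b => h b _) hmem]
    have h1 : h b₀ (blockCfg e σ b₀) = star (φ (blockCfg e σ b₀)) * χ₀ (blockCfg e σ b₀) := by
      simp [hh]
    have h1' : h b₁ (blockCfg e σ b₁) = star (φ (blockCfg e σ b₁)) * χ₁ (blockCfg e σ b₁) := by
      simp [hh, hb]
    have h2 : ∏ b ∈ (univ.erase b₀).erase b₁, h b (blockCfg e σ b) =
        ∏ b ∈ (univ.erase b₀).erase b₁, (star (φ (blockCfg e σ b)) * φ (blockCfg e σ b)) := by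
      refine prod_congr rfl fun b hb' => ?_
      have hb1 : b ≠ b₁ := (mem_erase.1 hb').1
      have hb0 : b ≠ b₀ := (mem_erase.1 (mem_erase.1 hb').2).1
      simp [hh, hb1, hb0]
    rw [h1, h1', h2, prod_mul_distrib]
    ring
  simp_rw [key]
  rw [sum_prod_blockCfg, ← mul_prod_erase _ _ (mem_univ b₀), ← mul_prod_erase _ _ hmem]
  have h1 : ∑ τ, h b₀ τ = ∑ τ, star (φ τ) * χ₀ τ := by simp [hh]
  have h1' : ∑ τ, h b₁ τ = ∑ τ, star (φ τ) * χ₁ τ := by simp [hh, hb]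
  have h2 : ∏ b ∈ (univ.erase b₀).erase b₁, ∑ τ, h b τ =
      ∏ b ∈ (univ.erase b₀).erase b₁, ∑ τ, star (φ τ) * φ τ := by
    refine prod_congr rfl fun b hb' => ?_
    have hb1 : b ≠ b₁ := (mem_erase.1 hb').1
    have hb0 : b ≠ b₀ := (mem_erase.1 (mem_erase.1 hb').2).1
    simp [hh, hb1, hb0]
  rw [h1, h1', h2, prod_const, card_erase_of_mem hmem, card_erase_of_mem (mem_univ b₀), card_univ,
    mul_assoc, show Fintype.card B - 1 - 1 = Fintype.card B - 2 from by omega]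

/-! ### Expectation values of one- and two-site observables -/

/-- **One-site expectation in a block product state**: `⟨Ψ, a_x Ψ⟩ = ⟨φ, a_f φ⟩ ⟨φ,φ⟩^{|B|-1}`
for `e x = (b₀, f)`. Tasaki (2020) §2.2. [folklore] -/
theorem blockProductState_expect_onSite (e : Λ ≃ B × F) (φ : TensorIndex F q → ℂ) {x : Λ} {b₀ : B}
    {f₀ : F} (hx : e x = (b₀, f₀)) (a : Matrix (Fin q) (Fin q) ℂ) :
    star (blockProductState e φ) ⬝ᵥ (onSite x a *ᵥ blockProductState e φ) =
      (star φ ⬝ᵥ (onSite f₀ a *ᵥ φ)) * (star φ ⬝ᵥ φ) ^ (Fintype.card B - 1) := by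
  rw [onSite_mulVec_blockProductState e φ hx, star_blockProductState_dotProduct_blockMod]

/-- **Two-site expectation, same block**: `⟨Ψ, a_x a'_y Ψ⟩ = ⟨φ, a_f a'_{f'} φ⟩ ⟨φ,φ⟩^{|B|-1}`
for `e x = (b₀, f)`, `e y = (b₀, f')`. Tasaki (2020) §2.2. [folklore] -/
theorem blockProductState_expect_onSite_onSite_same (e : Λ ≃ B × F) (φ : TensorIndex F q → ℂ)
    {x y : Λ} {b₀ : B} {f₀ f₁ : F} (hx : e x = (b₀, f₀)) (hy : e y = (b₀, f₁))
    (a a' : Matrix (Fin q) (Fin q) ℂ) :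
    star (blockProductState e φ) ⬝ᵥ (onSite x a *ᵥ (onSite y a' *ᵥ blockProductState e φ)) =
      (star φ ⬝ᵥ (onSite f₀ a *ᵥ (onSite f₁ a' *ᵥ φ))) * (star φ ⬝ᵥ φ) ^ (Fintype.card B - 1) := by
  rw [onSite_mulVec_blockProductState e φ hy, onSite_mulVec_blockMod_same e φ hx,
    star_blockProductState_dotProduct_blockMod]

/-- **Two-site expectation, different blocks**: `⟨Ψ, a_x a'_y Ψ⟩ = ⟨φ, a_f φ⟩ ⟨φ, a'_{f'} φ⟩ ⟨φ,φ⟩^{|B|-2}`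
for `e x = (b₀, f)`, `e y = (b₁, f')`, `b₀ ≠ b₁` (the correlations of a product state factorise).
Tasaki (2020) §2.2. [folklore] -/
theorem blockProductState_expect_onSite_onSite_ne (e : Λ ≃ B × F) (φ : TensorIndex F q → ℂ)
    {x y : Λ} {b₀ b₁ : B} {f₀ f₁ : F} (hx : e x = (b₀, f₀)) (hy : e y = (b₁, f₁)) (hb : b₀ ≠ b₁)
    (a a' : Matrix (Fin q) (Fin q) ℂ) :
    star (blockProductState e φ) ⬝ᵥ (onSite x a *ᵥ (onSite y a' *ᵥ blockProductState e φ)) =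
      (star φ ⬝ᵥ (onSite f₀ a *ᵥ φ)) * (star φ ⬝ᵥ (onSite f₁ a' *ᵥ φ)) *
        (star φ ⬝ᵥ φ) ^ (Fintype.card B - 2) := by
  rw [onSite_mulVec_blockProductState e φ hy, onSite_mulVec_blockMod_other e φ hx hb,
    star_blockProductState_dotProduct_blockMod₂ e φ hb]
  ring

end

end Literature.MathematicalPhysics.QuantumLattice

end
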